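import Summits.Parity.GeneralizedHardyLittlewood.Theorems.LeeYangFibresFibreHyperbolicityAlongDefs
import Summits.Parity.GeneralizedHardyLittlewood.Theorems.LeeYangFibresAbsoluteUpgradeClipCellsAux
import Summits.Parity.GeneralizedHardyLittlewood.Theorems.LeeYangFibresAbsoluteUpgradeQuantClipScale
import Summits.Parity.GeneralizedHardyLittlewood.Theorems.LeeYangFibresAbsoluteUpgradeAnatomyAlong
import HarnessLib

/-!
# Crux `FibreHyperbolicityAlong` (stmt-Parity-18103), line `sifted-chowla-distillation`:
# the necessity theorem `stub_mixedPolyOfAlong` — ONE-SCALE LEMMAS (helper file 1 of 2)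

The registered stub `stub_mixedPolyOfAlong` (file `…AlongNecessity.lean`) says: the crux (every fibre along the
schedule `U = slowDegree N` real-rooted on bodies of singular mass `≥ ηN`) together with the cell-parity law with a
log-power saving forces EVERY sifted Liouville correlation `siftedLiouvilleCorr t N U Ψ K S`, `S ≠ ∅`, below
`U^{-m} · N U^t/(log N)^t` for every `m` — the necessity counterpart of the open stub `stub_siftedChowlaMixedAlong`.
Its proof clips the Walsh amplitudes `θ_S` through the landed margin machinery (`quantClip_thetaSmall`) and then runs
the Walsh inversion of `stub_ghostFreeAlong` in the REVERSE direction.  This file holds the scale-free pieces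
(namespace `MixedPoly`):

* Walsh algebra: the twist `(∏_{k∈S}(-1)^{j_k}) Θ_θ(j) = (-1)^{|S|} Θ_{θ(S∆·)}(j)` (`sign_mul_walshForm`), the
  factorisation `Σ_{j∈[1,u]^t} Θ_θ(j) ∏_k a_{j_k} = Σ_T θ_T ∏_k g_{T,k}` with `g_{T,k} ∈ {Â, -Ã}`
  (`sum_walshForm_prod_eq`), and the UPPER bound `|Σ_j (∏_{k∈S}(-1)^{j_k}) Θ_θ(j) ∏_k a_{j_k}| ≤ |θ_S| Â^t +
  2^{t+1} |Ã| Â^{t-1}` (`abs_sum_sign_walsh_le`), whence for cells obeying the law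
  `|Σ_j (∏_{k∈S}(-1)^{j_k}) C_j| ≤ u^t e₁ + M(|θ_S| Â^t + 2^{t+1}|Ã| Â^{t-1})` (`abs_sum_sign_cells_le`);
* the exact identities `Σ_j (∏_{k∈S}(-1)^{j_k}) C_j = siftedLiouvilleCorr … S` (`N^{1/u} ≥ max(2, 2L)`) and
  `Σ_m (-1)^m A_m(N) = siftedLiouvilleCorr 1 N u idForm [-N,N] {0}`;
* numerics: the margin parameters at a general exponent `p` (`numericsP`, the `p`-version of
  `quantClip_numericsB`), `Â ≤ 2U²/log N` from the anatomy (`sum_density_le`), and the final size bookkeeping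
  `U^t E₀ + MS(τ Â^t + 2^{t+1}|Ã|Â^{t-1}) ≤ U^{-m} N U^t/(log N)^t` (`final_bound`, restated fully qualified as the
  registered helper stub `stub_mixedPolyOfAlongAux`).

No named facts are used.
-/

noncomputable section

namespace Summit.Parity.GeneralizedHardyLittlewood.Cruxes.FibreHyperbolicityAlong.SiftedChowlaDistillation

namespace MixedPoly

open scoped BigOperators Classical
open Finset
open Literature.NumberTheory.Sieve
open Summit.Parity.GeneralizedHardyLittlewood.Cruxes.ModelHyperbolicity.WindowChainTransport (cellDensity calc_nonneg)
open Summit.Parity.GeneralizedHardyLittlewood.Cruxes.FibreHyperbolicity.ModelTransfer (jointCell)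
open Summit.Parity.GeneralizedHardyLittlewood.Cruxes.AbsoluteUpgrade.NlcCellsAbsoluteClip (roughTuples walshForm)
open Summit.Parity.GeneralizedHardyLittlewood.Cruxes.AbsoluteUpgrade.DipMarginRateExchange (cellDensity_le_self
  quantClip_pow_le_exp_sq)
open Summit.Parity.GeneralizedHardyLittlewood.Theorems.ModelHyperbolicity.Negative (cell)
open Summit.Parity.GeneralizedHardyLittlewood.Theorems.AbsoluteUpgrade (abs_alt_sum_le_sum
  cellIndex_mem_piFinset jointCell_eq_card_filter sum_roughTuples_idForm)

variable {t : ℕ}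

/-! ### Walsh algebra -/

-- adapted from …Theorems/LeeYangFibresFibreHyperbolicityAlongGhostFreeAlong.lean (private helpers)
/-- Signs multiply over the symmetric difference: `∏_A s · ∏_B s = ∏_{A ∆ B} s` when `s_i² = 1`. -/
theorem prod_mul_prod_eq_prod_symmDiff {ι : Type*} [DecidableEq ι] (A B : Finset ι) (s : ι → ℝ)
    (hs : ∀ i, s i * s i = 1) : (∏ i ∈ A, s i) * ∏ i ∈ B, s i = ∏ i ∈ symmDiff A B, s i := by
  have h1 : (∏ i ∈ A ∪ B, s i) * ∏ i ∈ A ∩ B, s i = (∏ i ∈ A, s i) * ∏ i ∈ B, s i := prod_union_inter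
  have h2 : A ∪ B = symmDiff A B ∪ A ∩ B := (symmDiff_sup_inf A B).symm
  have h4 : (∏ i ∈ A ∩ B, s i) * ∏ i ∈ A ∩ B, s i = 1 := by rw [← prod_mul_distrib]; exact prod_eq_one fun i _ => hs i
  rw [← h1, h2, prod_union (show Disjoint (symmDiff A B) (A ∩ B) from disjoint_symmDiff_inf A B), mul_assoc, h4, mul_one]

-- adapted from …Theorems/LeeYangFibresFibreHyperbolicityAlongGhostFreeAlong.lean (private helpers)
/-- Walsh twist: `(∏_{k∈S} (-1)^{j_k}) Θ_θ(j) = (-1)^{|S|} Θ_{θ(S ∆ ·)}(j)` (`χ_S χ_T = χ_{S ∆ T}`; `T ↦ S ∆ T` is an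
involution of the sign sets). -/
theorem sign_mul_walshForm (θ : Finset (Fin t) → ℝ) (S : Finset (Fin t)) (j : Fin t → ℕ) :
    (∏ k ∈ S, (-1 : ℝ) ^ (j k)) * walshForm θ j = (-1) ^ S.card * walshForm (fun T => θ (symmDiff S T)) j := by
  have hS : ∏ k ∈ S, (-1 : ℝ) ^ (j k) = (-1) ^ S.card * ∏ k ∈ S, (-1 : ℝ) ^ (j k + 1) := by
    rw [← prod_const, ← prod_mul_distrib]; exact prod_congr rfl fun k _ => by ring
  rw [hS, mul_assoc]; refine congrArg ((-1 : ℝ) ^ S.card * ·) ?_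
  unfold walshForm; rw [mul_sum]
  refine Fintype.sum_bijective (fun T => symmDiff S T) (symmDiff_right_involutive S).bijective _ _ fun T => ?_
  have hsq : ∀ n : ℕ, (-1 : ℝ) ^ n * (-1) ^ n = 1 := fun n => by rw [← pow_add, ← two_mul, pow_mul]; simp
  dsimp only; rw [symmDiff_symmDiff_cancel_left, ← prod_mul_prod_eq_prod_symmDiff S T _ fun k => hsq _]; ring

/-- The UNSIGNED Walsh model sum factorises over the forms:
`Σ_{j ∈ [1,u]^t} Θ_θ(j) ∏_k a_{j_k} = Σ_T θ_T ∏_k (Σ_m a_m σ_{T,k}(m))`, `σ_{T,k}(m) = (-1)^{m+1}` if `k ∈ T`, else `1`. -/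
theorem sum_walshForm_prod_eq (θ : Finset (Fin t) → ℝ) (a : ℕ → ℝ) (u : ℕ) :
    ∑ j ∈ Fintype.piFinset (fun _ : Fin t => Icc 1 u), walshForm θ j * ∏ k, a (j k) =
      ∑ T : Finset (Fin t), θ T * ∏ k, ∑ m ∈ Icc 1 u, a m * (if k ∈ T then (-1 : ℝ) ^ (m + 1) else 1) := by
  -- adapted from `Theorems.AbsoluteUpgrade.sum_sign_walshForm_prod_eq` (…ClipCellsWalsh), without the sign `(-1)^{j_i}`
  have hterm : ∀ (j : Fin t → ℕ) (T : Finset (Fin t)),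
      (∏ k ∈ T, (-1 : ℝ) ^ (j k + 1)) * ∏ k, a (j k) = ∏ k, a (j k) * (if k ∈ T then (-1 : ℝ) ^ (j k + 1) else 1) := by
    intro j T
    rw [prod_mul_distrib, Fintype.prod_ite_mem]; ring
  calc ∑ j ∈ Fintype.piFinset (fun _ : Fin t => Icc 1 u), walshForm θ j * ∏ k, a (j k)
      = ∑ j ∈ Fintype.piFinset (fun _ : Fin t => Icc 1 u), ∑ T : Finset (Fin t),
          θ T * ∏ k, a (j k) * (if k ∈ T then (-1 : ℝ) ^ (j k + 1) else 1) := by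
        refine sum_congr rfl fun j _ => ?_
        rw [walshForm, sum_mul]
        refine sum_congr rfl fun T _ => ?_
        rw [← hterm j T]; ring
    _ = ∑ T : Finset (Fin t), θ T * ∑ j ∈ Fintype.piFinset (fun _ : Fin t => Icc 1 u),
          ∏ k, a (j k) * (if k ∈ T then (-1 : ℝ) ^ (j k + 1) else 1) := by
        rw [sum_comm]; exact sum_congr rfl fun T _ => (mul_sum _ _ _).symm
    _ = _ := by
        refine sum_congr rfl fun T _ => ?_
        congr 1
        exact sum_prod_piFinset (Icc 1 u) (fun k m => a m * (if k ∈ T then (-1 : ℝ) ^ (m + 1) else 1))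

/-- The two values of the unsigned marginal factors: `-Ã` on `T`, `Â` off `T`. -/
theorem margFactor_eq (a : ℕ → ℝ) (u : ℕ) (T : Finset (Fin t)) (k : Fin t) :
    ∑ m ∈ Icc 1 u, a m * (if k ∈ T then (-1 : ℝ) ^ (m + 1) else 1) =
      if k ∈ T then -∑ m ∈ Icc 1 u, (-1 : ℝ) ^ m * a m else ∑ m ∈ Icc 1 u, a m := by
  split_ifs with hk
  · rw [← sum_neg_distrib]; exact sum_congr rfl fun m _ => by rw [pow_succ]; ring
  · exact sum_congr rfl fun m _ => mul_one _

/-- **Reverse Walsh bound (every sign set).**  For amplitudes `|θ_T| ≤ 2` and densities `a ≥ 0`: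
`|Σ_{j∈[1,u]^t} (∏_{k∈S}(-1)^{j_k}) Θ_θ(j) ∏_k a_{j_k}| ≤ |θ_S| Â^t + 2^{t+1} |Ã| Â^{t-1}` (`Â = Σ_m a_m`,
`Ã = Σ_m (-1)^m a_m`): after the twist `φ = θ(S ∆ ·)` the `T = ∅` term is `θ_S Â^t` and each of the other `< 2^t`
terms carries a factor `Ã`. -/
theorem abs_sum_sign_walsh_le (θ : Finset (Fin t) → ℝ) (hθ : ∀ S, |θ S| ≤ 2) (a : ℕ → ℝ)
    (ha : ∀ m, 0 ≤ a m) (u : ℕ) (S : Finset (Fin t)) :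
    |∑ j ∈ Fintype.piFinset (fun _ : Fin t => Icc 1 u), (∏ k ∈ S, (-1 : ℝ) ^ (j k)) * (walshForm θ j * ∏ k, a (j k))| ≤
      |θ S| * (∑ m ∈ Icc 1 u, a m) ^ t +
        2 ^ (t + 1) * |∑ m ∈ Icc 1 u, (-1 : ℝ) ^ m * a m| * (∑ m ∈ Icc 1 u, a m) ^ (t - 1) := by
  obtain ⟨φ, hφ⟩ : ∃ φ : Finset (Fin t) → ℝ, ∀ T, φ T = θ (symmDiff S T) := ⟨_, fun _ => rfl⟩
  set A := ∑ m ∈ Icc 1 u, a m with hA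
  set B := |∑ m ∈ Icc 1 u, (-1 : ℝ) ^ m * a m| with hB
  set P := Fintype.piFinset (fun _ : Fin t => Icc 1 u) with hP
  have hA0 : 0 ≤ A := sum_nonneg fun m _ => ha m
  have hBA : B ≤ A := abs_alt_sum_le_sum a ha u
  -- the twist
  have h1 : ∑ j ∈ P, (∏ k ∈ S, (-1 : ℝ) ^ (j k)) * (walshForm θ j * ∏ k, a (j k)) =
      (-1) ^ S.card * ∑ j ∈ P, walshForm φ j * ∏ k, a (j k) := by
    rw [mul_sum]
    refine sum_congr rfl fun j _ => ?_
    rw [← mul_assoc, sign_mul_walshForm, show (fun T => θ (symmDiff S T)) = φ from funext fun T => (hφ T).symm]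
    ring
  rw [h1, abs_mul, abs_pow, abs_neg, abs_one, one_pow, one_mul, sum_walshForm_prod_eq]
  simp_rw [margFactor_eq a u]
  rw [← add_sum_erase univ _ (mem_univ (∅ : Finset (Fin t)))]
  -- the `T = ∅` term
  have h0 : φ ∅ * ∏ k : Fin t, (if k ∈ (∅ : Finset (Fin t)) then -∑ m ∈ Icc 1 u, (-1 : ℝ) ^ m * a m else A) =
      θ S * A ^ t := by
    simp only [notMem_empty, if_false, prod_const, card_univ, Fintype.card_fin, hφ]
    rw [show symmDiff S ∅ = S from symmDiff_bot S]
  -- the other terms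
  have hrest : |∑ T ∈ univ.erase ∅, φ T * ∏ k : Fin t, (if k ∈ T then -∑ m ∈ Icc 1 u, (-1 : ℝ) ^ m * a m else A)| ≤
      2 ^ (t + 1) * B * A ^ (t - 1) := by
    calc |∑ T ∈ univ.erase ∅, φ T * ∏ k : Fin t, (if k ∈ T then -∑ m ∈ Icc 1 u, (-1 : ℝ) ^ m * a m else A)|
        ≤ ∑ T ∈ univ.erase ∅, |φ T * ∏ k : Fin t, (if k ∈ T then -∑ m ∈ Icc 1 u, (-1 : ℝ) ^ m * a m else A)| :=
          abs_sum_le_sum_abs _ _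
      _ ≤ ∑ _T ∈ univ.erase ∅, 2 * (B * A ^ (t - 1)) := by
          refine sum_le_sum fun T hT => ?_
          rw [abs_mul]
          refine mul_le_mul (by rw [hφ]; exact hθ _) ?_ (abs_nonneg _) (by norm_num)
          obtain ⟨k₀, hk₀⟩ := nonempty_iff_ne_empty.mpr (ne_of_mem_erase hT)
          rw [abs_prod, ← mul_prod_erase univ _ (mem_univ k₀), if_pos hk₀, abs_neg]
          refine mul_le_mul_of_nonneg_left ?_ (abs_nonneg _)
          calc ∏ k ∈ univ.erase k₀, |(if k ∈ T then -∑ m ∈ Icc 1 u, (-1 : ℝ) ^ m * a m else A)|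
              ≤ ∏ _k ∈ univ.erase k₀, A := prod_le_prod (fun k _ => abs_nonneg _) fun k _ => by
                  split_ifs
                  · rw [abs_neg]; exact hBA
                  · rw [abs_of_nonneg hA0]
            _ = A ^ (t - 1) := by rw [prod_const, card_erase_of_mem (mem_univ k₀), card_univ, Fintype.card_fin]
      _ ≤ ∑ _T : Finset (Fin t), 2 * (B * A ^ (t - 1)) :=
          sum_le_sum_of_subset_of_nonneg (erase_subset _ _) fun _ _ _ => by positivity
      _ = 2 ^ (t + 1) * B * A ^ (t - 1) := by
          rw [sum_const, card_univ, Fintype.card_finset, Fintype.card_fin, nsmul_eq_mul, pow_succ]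
          push_cast; ring
  rw [h0]
  calc |θ S * A ^ t + ∑ T ∈ univ.erase ∅, φ T * ∏ k : Fin t, (if k ∈ T then -∑ m ∈ Icc 1 u, (-1 : ℝ) ^ m * a m else A)|
      ≤ |θ S * A ^ t| + |∑ T ∈ univ.erase ∅, φ T * ∏ k : Fin t, (if k ∈ T then -∑ m ∈ Icc 1 u, (-1 : ℝ) ^ m * a m else A)| :=
        abs_add_le _ _
    _ ≤ |θ S| * A ^ t + 2 ^ (t + 1) * B * A ^ (t - 1) := by
        rw [abs_mul, abs_of_nonneg (pow_nonneg hA0 t)]; exact add_le_add le_rfl hrest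

/-- **Cells to correlations, the reverse direction of `stub_ghostFreeAlong`.**  If the cells obey
`|C_j − Θ_θ(j) M ∏_k a_{j_k}| ≤ e₁` on `[1,u]^t` (`a ≥ 0`, `M ≥ 0`, `|θ_T| ≤ 2`), then for every sign set `S`
`|Σ_j (∏_{k∈S}(-1)^{j_k}) C_j| ≤ u^t e₁ + M (|θ_S| Â^t + 2^{t+1} |Ã| Â^{t-1})`. -/
theorem abs_sum_sign_cells_le (θ : Finset (Fin t) → ℝ) (hθ2 : ∀ S, |θ S| ≤ 2) (C : (Fin t → ℕ) → ℝ) {M : ℝ}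
    (hM : 0 ≤ M) (a : ℕ → ℝ) (ha : ∀ m, 0 ≤ a m) {u : ℕ} {e₁ : ℝ} (S : Finset (Fin t))
    (hlaw : ∀ j ∈ Fintype.piFinset (fun _ : Fin t => Icc 1 u), |C j - walshForm θ j * (M * ∏ k, a (j k))| ≤ e₁) :
    |∑ j ∈ Fintype.piFinset (fun _ : Fin t => Icc 1 u), (∏ k ∈ S, (-1 : ℝ) ^ (j k)) * C j| ≤
      (u : ℝ) ^ t * e₁ + M * (|θ S| * (∑ m ∈ Icc 1 u, a m) ^ t +
        2 ^ (t + 1) * |∑ m ∈ Icc 1 u, (-1 : ℝ) ^ m * a m| * (∑ m ∈ Icc 1 u, a m) ^ (t - 1)) := by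
  -- adapted from the private `abs_theta_le` of …AlongGhostFreeAlong.lean (error bookkeeping), reversed
  set P := Fintype.piFinset (fun _ : Fin t => Icc 1 u) with hP
  have hdecomp : ∑ j ∈ P, (∏ k ∈ S, (-1 : ℝ) ^ (j k)) * C j =
      ∑ j ∈ P, (∏ k ∈ S, (-1 : ℝ) ^ (j k)) * (C j - walshForm θ j * (M * ∏ k, a (j k))) +
        M * ∑ j ∈ P, (∏ k ∈ S, (-1 : ℝ) ^ (j k)) * (walshForm θ j * ∏ k, a (j k)) := by
    rw [mul_sum, ← sum_add_distrib]; exact sum_congr rfl fun j _ => by ring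
  have hE : |∑ j ∈ P, (∏ k ∈ S, (-1 : ℝ) ^ (j k)) * (C j - walshForm θ j * (M * ∏ k, a (j k)))| ≤ (u : ℝ) ^ t * e₁ :=
    calc |∑ j ∈ P, (∏ k ∈ S, (-1 : ℝ) ^ (j k)) * (C j - walshForm θ j * (M * ∏ k, a (j k)))|
        ≤ ∑ j ∈ P, |(∏ k ∈ S, (-1 : ℝ) ^ (j k)) * (C j - walshForm θ j * (M * ∏ k, a (j k)))| :=
          abs_sum_le_sum_abs _ _
      _ ≤ ∑ _j ∈ P, e₁ := sum_le_sum fun j hj => by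
          rw [abs_mul, prod_pow_eq_pow_sum, abs_neg_one_pow, one_mul]; exact hlaw j hj
      _ = (u : ℝ) ^ t * e₁ := by
          rw [sum_const, nsmul_eq_mul, hP, Fintype.card_piFinset_const, Nat.card_Icc, Nat.add_sub_cancel]
          push_cast; ring
  rw [hdecomp]
  calc _ ≤ |∑ j ∈ P, (∏ k ∈ S, (-1 : ℝ) ^ (j k)) * (C j - walshForm θ j * (M * ∏ k, a (j k)))| +
        |M * ∑ j ∈ P, (∏ k ∈ S, (-1 : ℝ) ^ (j k)) * (walshForm θ j * ∏ k, a (j k))| := abs_add_le _ _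
    _ ≤ _ := add_le_add hE (by
        rw [abs_mul, abs_of_nonneg hM]
        exact mul_le_mul_of_nonneg_left (abs_sum_sign_walsh_le θ hθ2 a ha u S) hM)

/-! ### Exact identities -/

-- adapted from …Theorems/LeeYangFibresFibreHyperbolicityAlongGhostFreeAlong.lean (private helpers)
/-- **Exact identity.** Once `N^{1/u} ≥ max(2, 2L)` the rough tuples are the disjoint union of the joint cells `C_j`,
`j ∈ [1,u]^t`, so `Σ_j (∏_{k∈S} (-1)^{j_k}) C_j = Σ_{rough tuples} ∏_{k∈S} λ(ψ_k(n))`. -/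
theorem sum_sign_jointCell_eq_corr (Ψ : Fin t → AffLinForm 1) (K : Set (Fin 1 → ℝ)) {N u L : ℕ}
    (hN : 1 ≤ N) (hu : 1 ≤ u) (hL : affLinSize Ψ N ≤ L) (hz2 : (2 : ℝ) ≤ (N : ℝ) ^ ((1 : ℝ) / u))
    (hzL : (2 * L : ℝ) ≤ (N : ℝ) ^ ((1 : ℝ) / u)) (S : Finset (Fin t)) :
    ∑ j ∈ Fintype.piFinset (fun _ : Fin t => Icc 1 u), (∏ k ∈ S, (-1 : ℝ) ^ (j k)) * (jointCell t N u Ψ K j : ℝ) =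
      (siftedLiouvilleCorr t N u Ψ K S : ℝ) := by
  have hmaps : ∀ n ∈ roughTuples Ψ K N u, (fun k => ArithmeticFunction.cardFactors ((Ψ k).eval n).toNat) ∈
      Fintype.piFinset (fun _ : Fin t => Icc 1 u) := fun n hn => cellIndex_mem_piFinset Ψ K hN hu hL hz2 hzL hn
  rw [siftedLiouvilleCorr]
  push_cast
  rw [← sum_fiberwise_of_maps_to' hmaps (fun j : Fin t → ℕ => ∏ k ∈ S, (-1 : ℝ) ^ (j k))]
  refine sum_congr rfl fun j _ => ?_
  rw [sum_const, nsmul_eq_mul, jointCell_eq_nlc, jointCell_eq_card_filter, mul_comm]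

-- adapted from …Theorems/LeeYangFibresFibreHyperbolicityAlongGhostFreeAlong.lean (private helpers)
/-- The alternating model-cell sum is the `t = 1` correlation of the identity form on `[-N, N]`:
`Σ_{m ≤ u} (-1)^m A_m(N) = siftedLiouvilleCorr 1 N u (n) [-N,N] {0}` (for `N^{1/u} ≥ 2`). -/
theorem altSum_cell_eq_corr {N u : ℕ} (hN : 1 ≤ N) (hu : 1 ≤ u) (hz2 : (2 : ℝ) ≤ (N : ℝ) ^ ((1 : ℝ) / u)) :
    ∑ m ∈ Icc 1 u, (-1 : ℝ) ^ m * (cell u N m : ℝ) = (siftedLiouvilleCorr 1 N u idForm (realBox 1 N) {0} : ℝ) := by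
  rw [siftedLiouvilleCorr]
  push_cast
  simp_rw [prod_singleton]
  rw [sum_roughTuples_idForm hN hu hz2]
  rfl

/-! ### Numerics -/

/-- **The margin parameters at exponent `p` against the saving** (the `p`-version of `quantClip_numericsB`).  If
`2^{t+1} U^{U+p+t-1}/η ≤ Lg^δ` and `p + 4 ≤ U`, then `ν₀ = 2^{t-1} U^{t-1}/(η Lg^δ)` satisfies `4ν₀ ≤ U^{-p}`,
`ν₀ ≤ U^{-p} U^{-U}`, and `3 e^{-U²}/8 ≤ U^{-p-4}`. -/
theorem numericsP {t U p : ℕ} (ht : 1 ≤ t) (hpU : p + 4 ≤ U) {η Lg δ : ℝ} (hη : 0 < η)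
    (hLgδ : 0 < Lg ^ δ) (hκδ : 2 ^ (t + 1) / η * (U : ℝ) ^ (U + (p + t - 1)) ≤ Lg ^ δ) :
    4 * (2 ^ (t - 1) * (U : ℝ) ^ (t - 1) / (η * Lg ^ δ)) ≤ ((U : ℝ) ^ p)⁻¹ ∧
      2 ^ (t - 1) * (U : ℝ) ^ (t - 1) / (η * Lg ^ δ) ≤ ((U : ℝ) ^ p)⁻¹ * ((U : ℝ) ^ U)⁻¹ ∧
      3 * (Real.exp (-((U : ℝ) ^ 2)) / 8) ≤ ((U : ℝ) ^ (p + 4))⁻¹ := by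
  -- adapted from `quantClip_numericsB` (…QuantClipScale), exponent `2t ↦ p`
  have hU1 : (1 : ℝ) ≤ U := by exact_mod_cast (show 1 ≤ U by omega)
  have hpow : (U : ℝ) ^ (t - 1) * ((U : ℝ) ^ p * (U : ℝ) ^ U) = (U : ℝ) ^ (U + (p + t - 1)) := by
    rw [← pow_add, ← pow_add]; congr 1; omega
  have h22 : (4 : ℝ) * 2 ^ (t - 1) = 2 ^ (t + 1) := by
    rw [show t + 1 = (t - 1) + 2 by omega, pow_add]; norm_num; ring
  have hmain : 2 ^ (t + 1) * (U : ℝ) ^ (U + (p + t - 1)) ≤ η * Lg ^ δ := by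
    have := hκδ
    rw [div_mul_eq_mul_div, div_le_iff₀ hη] at this
    linarith
  have hνϑf : 4 * (2 ^ (t - 1) * (U : ℝ) ^ (t - 1) / (η * Lg ^ δ)) ≤ ((U : ℝ) ^ p)⁻¹ * ((U : ℝ) ^ U)⁻¹ := by
    have hgoal : 4 * (2 ^ (t - 1) * (U : ℝ) ^ (t - 1)) / (η * Lg ^ δ) ≤ 1 / ((U : ℝ) ^ p * (U : ℝ) ^ U) := by
      rw [div_le_div_iff₀ (mul_pos hη hLgδ) (by positivity), one_mul]
      calc 4 * (2 ^ (t - 1) * (U : ℝ) ^ (t - 1)) * ((U : ℝ) ^ p * (U : ℝ) ^ U)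
          = (4 * 2 ^ (t - 1)) * ((U : ℝ) ^ (t - 1) * ((U : ℝ) ^ p * (U : ℝ) ^ U)) := by ring
        _ = 2 ^ (t + 1) * (U : ℝ) ^ (U + (p + t - 1)) := by rw [hpow, h22]
        _ ≤ η * Lg ^ δ := hmain
    calc 4 * (2 ^ (t - 1) * (U : ℝ) ^ (t - 1) / (η * Lg ^ δ))
        = 4 * (2 ^ (t - 1) * (U : ℝ) ^ (t - 1)) / (η * Lg ^ δ) := by ring
      _ ≤ 1 / ((U : ℝ) ^ p * (U : ℝ) ^ U) := hgoal
      _ = ((U : ℝ) ^ p)⁻¹ * ((U : ℝ) ^ U)⁻¹ := by rw [one_div, mul_inv]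
  have hf1 : ((U : ℝ) ^ U)⁻¹ ≤ 1 := inv_le_one_of_one_le₀ (one_le_pow₀ hU1)
  have hϑ0 : 0 ≤ ((U : ℝ) ^ p)⁻¹ := by positivity
  have hν0 : 0 ≤ 2 ^ (t - 1) * (U : ℝ) ^ (t - 1) / (η * Lg ^ δ) := div_nonneg (by positivity) (mul_pos hη hLgδ).le
  refine ⟨le_trans hνϑf (mul_le_of_le_one_right hϑ0 hf1), le_trans (by linarith) hνϑf, ?_⟩
  have h1 : (U : ℝ) ^ (p + 4) ≤ Real.exp ((U : ℝ) ^ 2) := quantClip_pow_le_exp_sq hpU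
  have h2 : Real.exp (-((U : ℝ) ^ 2)) ≤ ((U : ℝ) ^ (p + 4))⁻¹ := by
    rw [Real.exp_neg]; exact inv_anti₀ (by positivity) h1
  linarith [Real.exp_pos (-((U : ℝ) ^ 2))]

/-- **`Â ≤ 2U²/log N` from the anatomy**: if `|a_n Lg − I_{n-1}(U)| ≤ εa I_{n-1}(U)` for `1 ≤ n ≤ U` with
`εa ≤ 1` (and `I_{n-1}(U) ≤ U`, `cellDensity_le_self`), then `Σ_{n ≤ U} a_n ≤ 2U²/Lg`. -/
theorem sum_density_le {U : ℕ} (hU1 : 1 ≤ U) {Lg εa : ℝ} (hLg : 0 < Lg) (hεa : εa ≤ 1) (a : ℕ → ℝ)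
    (hanat : ∀ n ∈ Icc 1 U, |a n * Lg - cellDensity (n - 1) U| ≤ εa * cellDensity (n - 1) U) :
    ∑ n ∈ Icc 1 U, a n ≤ 2 * (U : ℝ) ^ 2 / Lg := by
  have hU1' : (1 : ℝ) ≤ U := by exact_mod_cast hU1
  have hterm : ∀ n ∈ Icc 1 U, a n ≤ 2 * U / Lg := fun n hn => by
    have h := (abs_le.mp (hanat n hn)).2
    have hcd : cellDensity (n - 1) (U : ℝ) ≤ U := cellDensity_le_self _ hU1'
    have hcd0 : 0 ≤ cellDensity (n - 1) (U : ℝ) := calc_nonneg _ _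
    rw [le_div_iff₀ hLg]
    nlinarith
  calc ∑ n ∈ Icc 1 U, a n ≤ ∑ _n ∈ Icc 1 U, 2 * (U : ℝ) / Lg := sum_le_sum hterm
    _ = U * (2 * U / Lg) := by rw [sum_const, Nat.card_Icc, Nat.add_sub_cancel, nsmul_eq_mul]
    _ = 2 * (U : ℝ) ^ 2 / Lg := by ring

/-- `U^p e^{-(p+1)U} ≤ e^{-U} ≤ 1` (from `U ≤ e^U`). -/
theorem pow_mul_exp_neg_le {U : ℝ} (hU : 0 ≤ U) (p : ℕ) :
    U ^ p * Real.exp (-(((p : ℝ) + 1) * U)) ≤ 1 := by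
  have hUe : U ≤ Real.exp U := by linarith [Real.add_one_le_exp U]
  have hUp : U ^ p ≤ Real.exp (p * U) := by rw [Real.exp_nat_mul]; exact pow_le_pow_left₀ hU hUe p
  calc U ^ p * Real.exp (-(((p : ℝ) + 1) * U)) ≤ Real.exp (p * U) * Real.exp (-(((p : ℝ) + 1) * U)) := by gcongr
    _ = Real.exp (-U) := by rw [← Real.exp_add]; congr 1; ring
    _ ≤ 1 := Real.exp_le_one_iff.mpr (by linarith)

/-- **The final size bookkeeping at one scale** (`t = s + 1`).  With `E₀ = N/(Lg^t D)`, `3U^m ≤ D`,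
`MS ≤ C_g N ll^s`, `ll ≤ (2U+2)²`, `Â ≤ 2U²/Lg`, `|Ã| ≤ e^{-(p+1)U} U/Lg`, `τ ≤ 8^s(2^t+1) U^{-p}`, `p = m + 4t`,
and `U` above the two constants `3 C_g 4^{2s} 2^t 8^s (2^t+1)`, `3 C_g 4^{2s} 2^{t+1} 2^s`:
`U^t E₀ + MS (τ Â^t + 2^{t+1} |Ã| Â^s) ≤ U^{-m} N U^t / Lg^t`. -/
theorem final_bound {s m U : ℕ} (hU1 : 1 ≤ U) {N Lg D MS Ap Am τ X Cg ll : ℝ}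
    (hN : 0 < N) (hLg : 0 < Lg) (hCg : 0 < Cg) (hMSle : MS ≤ Cg * N * ll ^ s) (hll0 : 0 ≤ ll) (hll : ll ≤ (2 * (U : ℝ) + 2) ^ 2)
    (hAp0 : 0 ≤ Ap) (hAp : Ap ≤ 2 * (U : ℝ) ^ 2 / Lg)
    (hAm0 : 0 ≤ Am) (hAm : Am ≤ Real.exp (-((((m + 4 * (s + 1) : ℕ) : ℝ) + 1) * U)) * U / Lg)
    (hτ0 : 0 ≤ τ) (hτ : τ ≤ 8 ^ s * (2 ^ (s + 1) + 1) * ((U : ℝ) ^ (m + 4 * (s + 1)))⁻¹)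
    (hDm : 3 * (U : ℝ) ^ m ≤ D)
    (hK₂ : 3 * (Cg * 4 ^ (2 * s) * 2 ^ (s + 1) * (8 ^ s * (2 ^ (s + 1) + 1))) ≤ U)
    (hK₃ : 3 * (Cg * 4 ^ (2 * s) * 2 ^ (s + 1 + 1) * 2 ^ s) ≤ U)
    (hX : X ≤ (U : ℝ) ^ (s + 1) * (N / (Lg ^ (s + 1) * D)) +
      MS * (τ * Ap ^ (s + 1) + 2 ^ (s + 1 + 1) * Am * Ap ^ s)) :
    X ≤ ((U : ℝ) ^ m)⁻¹ * N * (U : ℝ) ^ (s + 1) / Lg ^ (s + 1) := by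
  have hU1' : (1 : ℝ) ≤ U := by exact_mod_cast hU1
  have hU0 : (0 : ℝ) < U := by linarith
  set R : ℝ := ((U : ℝ) ^ m)⁻¹ * N * (U : ℝ) ^ (s + 1) / Lg ^ (s + 1) with hR
  have hR0 : 0 ≤ R := by positivity
  -- `ll^s ≤ (4U)^{2s}` and the mass
  have hll' : ll ^ s ≤ ((4 : ℝ) * U) ^ (2 * s) := by
    have h1 : ll ≤ ((4 : ℝ) * U) ^ 2 := le_trans hll (by nlinarith)
    calc ll ^ s ≤ (((4 : ℝ) * U) ^ 2) ^ s := pow_le_pow_left₀ hll0 h1 _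
      _ = ((4 : ℝ) * U) ^ (2 * s) := by rw [← pow_mul]
  have hMS' : MS ≤ Cg * N * ((4 : ℝ) * U) ^ (2 * s) := hMSle.trans (by gcongr)
  -- term (i): the law's own error
  have hT1 : (U : ℝ) ^ (s + 1) * (N / (Lg ^ (s + 1) * D)) ≤ R / 3 := by
    have h1 : N / (Lg ^ (s + 1) * D) ≤ N / (Lg ^ (s + 1) * (3 * (U : ℝ) ^ m)) :=
      div_le_div_of_nonneg_left hN.le (by positivity) (by gcongr)
    calc (U : ℝ) ^ (s + 1) * (N / (Lg ^ (s + 1) * D)) ≤ (U : ℝ) ^ (s + 1) * (N / (Lg ^ (s + 1) * (3 * (U : ℝ) ^ m))) :=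
          mul_le_mul_of_nonneg_left h1 (by positivity)
      _ = R / 3 := by rw [hR]; field_simp
  -- term (ii): the clipped amplitude
  have hT2 : MS * (τ * Ap ^ (s + 1)) ≤ R / 3 := by
    have h1 : MS * (τ * Ap ^ (s + 1)) ≤ (Cg * N * ((4 : ℝ) * U) ^ (2 * s)) *
        ((8 ^ s * (2 ^ (s + 1) + 1) * ((U : ℝ) ^ (m + 4 * (s + 1)))⁻¹) * (2 * (U : ℝ) ^ 2 / Lg) ^ (s + 1)) :=
      mul_le_mul hMS' (mul_le_mul hτ (pow_le_pow_left₀ hAp0 hAp _) (by positivity) (by positivity))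
        (by positivity) (by positivity)
    have h2 : (Cg * N * ((4 : ℝ) * U) ^ (2 * s)) *
        ((8 ^ s * (2 ^ (s + 1) + 1) * ((U : ℝ) ^ (m + 4 * (s + 1)))⁻¹) * (2 * (U : ℝ) ^ 2 / Lg) ^ (s + 1)) =
        (3 * (Cg * 4 ^ (2 * s) * 2 ^ (s + 1) * (8 ^ s * (2 ^ (s + 1) + 1)))) * ((U : ℝ) ^ (s + 3))⁻¹ * (R / 3) := by
      rw [hR, div_pow, mul_pow, mul_pow]
      field_simp
      ring
    have h3 : (3 * (Cg * 4 ^ (2 * s) * 2 ^ (s + 1) * (8 ^ s * (2 ^ (s + 1) + 1)))) * ((U : ℝ) ^ (s + 3))⁻¹ ≤ 1 := by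
      rw [mul_inv_le_iff₀ (by positivity), one_mul]
      exact hK₂.trans (le_self_pow₀ hU1' (by omega))
    calc MS * (τ * Ap ^ (s + 1)) ≤ _ := h1
      _ = _ := h2
      _ ≤ 1 * (R / 3) := mul_le_mul_of_nonneg_right h3 (by positivity)
      _ = R / 3 := one_mul _
  -- term (iii): the parity balance
  have hT3 : MS * (2 ^ (s + 1 + 1) * Am * Ap ^ s) ≤ R / 3 := by
    have hE := pow_mul_exp_neg_le hU0.le (m + 4 * (s + 1))
    set E : ℝ := Real.exp (-((((m + 4 * (s + 1) : ℕ) : ℝ) + 1) * U)) with hEdef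
    have hE0 : 0 < E := Real.exp_pos _
    have h1 : MS * (2 ^ (s + 1 + 1) * Am * Ap ^ s) ≤ (Cg * N * ((4 : ℝ) * U) ^ (2 * s)) *
        (2 ^ (s + 1 + 1) * (E * U / Lg) * (2 * (U : ℝ) ^ 2 / Lg) ^ s) :=
      mul_le_mul hMS' (mul_le_mul (mul_le_mul_of_nonneg_left hAm (by positivity))
        (pow_le_pow_left₀ hAp0 hAp _) (by positivity) (by positivity)) (by positivity) (by positivity)
    have h2 : (Cg * N * ((4 : ℝ) * U) ^ (2 * s)) * (2 ^ (s + 1 + 1) * (E * U / Lg) * (2 * (U : ℝ) ^ 2 / Lg) ^ s) =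
        (3 * (Cg * 4 ^ (2 * s) * 2 ^ (s + 1 + 1) * 2 ^ s)) * ((U : ℝ) ^ (s + 4))⁻¹ *
          ((U : ℝ) ^ (m + 4 * (s + 1)) * E) * (R / 3) := by
      rw [hR, div_pow, mul_pow, mul_pow]
      field_simp
      ring
    have h3 : (3 * (Cg * 4 ^ (2 * s) * 2 ^ (s + 1 + 1) * 2 ^ s)) * ((U : ℝ) ^ (s + 4))⁻¹ ≤ 1 := by
      rw [mul_inv_le_iff₀ (by positivity), one_mul]
      exact hK₃.trans (le_self_pow₀ hU1' (by omega))
    calc MS * (2 ^ (s + 1 + 1) * Am * Ap ^ s) ≤ _ := h1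
      _ = _ := h2
      _ ≤ 1 * 1 * (R / 3) := by gcongr
      _ = R / 3 := by ring
  linarith [hX, hT1, hT2, hT3]

end MixedPoly

/-! ## Registered-stub form (for `--supports stmt-Parity-18103`) -/

/-- **Stub form of `MixedPoly.final_bound`** (helper stub `stub_mixedPolyOfAlongAux` of the line
`sifted-chowla-distillation`, Aux of `stub_mixedPolyOfAlong`; the header below is the registered one-line signature
verbatim, Mathlib-only): the size bookkeeping of one scale of the necessity theorem,
`U^t E₀ + MS (τ Â^t + 2^{t+1} |Ã| Â^{t-1}) ≤ U^{-m} N U^t/Lg^t` (`t = s + 1`). -/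
theorem stub_mixedPolyOfAlongAux : ∀ (s m U : ℕ), 1 ≤ U → ∀ (N Lg D MS Ap Am τ X Cg ll : ℝ), 0 < N → 0 < Lg → 0 < Cg → MS ≤ Cg * N * ll ^ s → 0 ≤ ll → ll ≤ (2 * (U : ℝ) + 2) ^ 2 → 0 ≤ Ap → Ap ≤ 2 * (U : ℝ) ^ 2 / Lg → 0 ≤ Am → Am ≤ Real.exp (-((((m + 4 * (s + 1) : ℕ) : ℝ) + 1) * U)) * U / Lg → 0 ≤ τ → τ ≤ 8 ^ s * (2 ^ (s + 1) + 1) * ((U : ℝ) ^ (m + 4 * (s + 1)))⁻¹ → 3 * (U : ℝ) ^ m ≤ D → 3 * (Cg * 4 ^ (2 * s) * 2 ^ (s + 1) * (8 ^ s * (2 ^ (s + 1) + 1))) ≤ U → 3 * (Cg * 4 ^ (2 * s) * 2 ^ (s + 1 + 1) * 2 ^ s) ≤ U → X ≤ (U : ℝ) ^ (s + 1) * (N / (Lg ^ (s + 1) * D)) + MS * (τ * Ap ^ (s + 1) + 2 ^ (s + 1 + 1) * Am * Ap ^ s) → X ≤ ((U : ℝ) ^ m)⁻¹ * N * (U : ℝ)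 ^ (s + 1) / Lg ^ (s + 1) := by
  intro s m U hU N Lg D MS Ap Am τ X Cg ll hN hLg hCg hMSle hll0 hll hAp0 hAp hAm0 hAm hτ0 hτ hDm hK₂ hK₃ hX
  exact MixedPoly.final_bound hU hN hLg hCg hMSle hll0 hll hAp0 hAp hAm0 hAm hτ0 hτ hDm hK₂ hK₃ hX

end Summit.Parity.GeneralizedHardyLittlewood.Cruxes.FibreHyperbolicityAlong.SiftedChowlaDistillation

end
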